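import Literature.Barriers.AnomalousDissipation.ObukhovCorrsinThresholdForced
import Literature.Analysis.FluidPDE.LongTimeAverageSlidingWindow
import HarnessLib

/-!
# The Obukhov–Corrsin threshold PER UNIT TIME: long-time means (barrier audit 2026-08-17, gen 16)

Proof-support module for the barrier `Literature.Barriers.AnomalousDissipation.DrivasElgindiIyerJeong2022_thm4`
(`Barriers/AnomalousDissipation/ObukhovCorrsinThreshold`), scope caveat (ii) ("REACH IN TIME AND
FORCING"). The print (Drivas–Elgindi–Iyer–Jeong 2022, Thm. 4) and the named fact live on a finite
window `[0,T]` with a constant `C = C(T, …)`, whereas the summit `Literature.Turb.ZerothLaw` and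
crux `ScalarAnomalySteadySourceFormal` of route TwoAndHalfD are phrased with LONG-TIME MEANS
`⟨g⟩ = limsup_{T→∞} T⁻¹∫₀ᵀ g` (`Literature.Analysis.FluidPDE.longTimeAvgSup`), a steady source, and
a positive floor `ε ≤ ⟨κ‖∇θ‖²⟩`. Caveat (ii) recorded ON PAPER that the printed fixed-scale bound
(5.10) is affine in the window length and in the velocity budget, so that per unit time the
obstruction is uniform in `T`. This file makes that transcription a theorem, in the currency of the
crux (`longTimeAvgSup (fun t => κ * (eScalarGradNormSq (θ t)).toReal)`):

* `LongTimeCorner.timeMean_dissipationRate_le` — bookkeeping: a window bound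
  `2κ∫₀ᵀ‖∇θ‖² ≤ R` (in `ℝ≥0∞`, spectral) bounds the running mean of the real dissipation rate,
  `⟨κ‖∇θ‖²⟩_T ≤ R/(2T)` (junk included: a non-integrable rate has running mean `0`);
* `DrivasElgindiIyerJeong2022_thm4_forced.longTimeAvgSup_le_fixedScale` — the fixed-scale bound
  per unit time: for a field with velocity budget `‖u‖_{L¹(0,T;C^{0,α})} ≤ K(T) ≤ K₀ + k̄T` for every
  `T > 0`, a continuous steady `γ`-Hölder source (constant `L`), a datum and a GLOBAL weak solution
  (`Torus.IsWeakScalarTransportForced`) obeying the sourced energy inequality and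
  `ess sup_{t>0} ‖θ(t)‖_{C^{0,β}} ≤ M`, and every scale `0 < ε ≤ 1/4`,
  `⟨κ‖∇θ‖²⟩ ≤ 2dC₁M²k̄ ε^{α+2β-1} + dC₁²M² κε^{2β-2} + 2LM ε^γ` — the datum term `M²ε^{2β}` and the
  transient budget `K₀` are free per unit time;
* `DrivasElgindiIyerJeong2022_thm4_forced_longTime` — the optimised bound in the quantifier shape of
  the named fact: `⟨κ‖∇θ‖²⟩ ≤ C (κ^{(α+2β-1)/(α+1)} + κ^{γ/(α+1)})` with
  `C = C(d, α, β, γ, k̄, M, L, κ₀)` INDEPENDENT of `K₀`, of the datum and of any window;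
* `DrivasElgindiIyerJeong2022_thm4_longTime` — the unforced case (`h = 0`): `⟨κ‖∇θ‖²⟩ ≤ C κ^{(α+2β-1)/(α+1)}`,
  `C = C(d, α, β, k̄, M, κ₀)`;
* `DrivasElgindiIyerJeong2022_thm4_forced_longTime.noAnomalousMeanScalarDissipation` — the family
  corollary: above the line `α + 2β > 1`, `γ > 0`, along `κ_j → 0` with `j`-dependent fields,
  sources, data AND transient budgets `K₀(j)` (only the per-unit-time rate `k̄` being uniform), the
  mean scalar dissipation tends to `0`; so no such family meets a floor `ε ≤ ⟨κ_j‖∇θ_j‖²⟩`, `ε > 0`.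

## Proof

For every `T > 0` the accepted fixed-scale bound
`DrivasElgindiIyerJeong2022_thm4_forced.two_mul_eScalarDissipation_le` (module
`Barriers/AnomalousDissipation/ObukhovCorrsinThresholdForced`; Drivas–Elgindi–Iyer–Jeong 2022, §5,
(5.9)–(5.10) plus the source defect) gives
`2κ∫₀ᵀ‖∇θ‖² ≤ M²ε^{2β} + 2(c₁K(T) + Tκc₂) + 4TLMε^γ`, `c₁ = 2dC₁M²ε^{α+2β-1}`, `c₂ = dC₁²M²ε^{2β-2}`,
at a scale `ε` that does NOT depend on `T`; dividing by `2T` and letting `T → ∞`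
(`longTimeAvgSup_le_of_eventually_le`) leaves `c₁k̄ + κc₂ + 2LMε^γ`, and the choice
`ε = ¼κ₀^{-1/(α+1)} κ^{1/(α+1)}` of the window theorems (`scale_bound` with vanishing datum
coefficient) gives the two powers of `κ`. This is the printed remark that `C` depends on `T` only
through `|u|_{L¹(t,T;C^α)}` and the factor `κ(T-t)` of (5.10).

## References

* T. D. Drivas, T. M. Elgindi, G. Iyer, I.-J. Jeong, Arch. Ration. Mech. Anal. 243 (2022),
  Thm. 4 and its proof, §5, (5.9)–(5.10) (arXiv:1911.03271, pp. 17–18: "(5.10) … Setting `t = 0`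
  and optimizing `ℓ` as a function of `κ`"). Bib key `DrivasEtAl2022`.
* P. Constantin, W. E, E. S. Titi, Comm. Math. Phys. 165 (1994), (6)–(11). Bib key
  `ConstantinETiti1994`.
* C. R. Doering, C. Foias, J. Fluid Mech. 467 (2002), §2 (long-time `limsup` means). Bib key
  `DoeringFoias2002`.
-/

open MeasureTheory Set Filter Topology
open scoped ENNReal NNReal

noncomputable section

namespace Literature.Barriers.AnomalousDissipation

open Literature.Analysis Literature.Analysis.FunctionSpaces Literature.Analysis.FluidPDE

/-! ## From a window bound to the running mean -/

namespace LongTimeCorner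

/-- **Window bound ⇒ running-mean bound**: if `κ > 0`, `T > 0`, `R ≥ 0` and
`2 · (κ∫⁻_{(0,T)} ‖∇θ‖²) ≤ R` (spectral, in `ℝ≥0∞`), then the running mean of the real dissipation
rate obeys `T⁻¹∫₀ᵀ κ‖∇θ(t)‖² dt ≤ R/(2T)` (`timeMean`; the Bochner integral of the `toReal` rate is
dominated by the lower integral, and is the junk `0` when the rate is not integrable). [folklore] -/
theorem timeMean_dissipationRate_le {d : Type*} [Fintype d] {κ : ℝ} (hκ : 0 < κ)
    {θ : ℝ → UnitAddTorus d → ℝ} {T : ℝ} (hT : 0 < T) {R : ℝ} (hR : 0 ≤ R)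
    (h : 2 * Torus.eScalarDissipation κ θ 0 T ≤ ENNReal.ofReal R) :
    timeMean (fun t => κ * (Torus.eScalarGradNormSq (θ t)).toReal) T ≤ T⁻¹ * (R / 2) := by
  set D : ℝ≥0∞ := Torus.eScalarDissipation κ θ 0 T with hD
  -- `D` is finite and `D.toReal ≤ R / 2`
  have h2D : 2 * D < ⊤ := lt_of_le_of_lt h ENNReal.ofReal_lt_top
  have hDle : D ≤ 2 * D := by
    calc D = 1 * D := (one_mul D).symm
      _ ≤ 2 * D := by gcongr; exact one_le_two
  have hDfin : D ≠ ⊤ := (lt_of_le_of_lt hDle h2D).ne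
  have hDR : 2 * D.toReal ≤ R := by
    have := (ENNReal.toReal_mono ENNReal.ofReal_ne_top h).trans_eq (ENNReal.toReal_ofReal hR)
    simpa [ENNReal.toReal_mul] using this
  -- the lower integral of the spectral rate is finite
  have hIfin : ∫⁻ t in Ioo 0 T, Torus.eScalarGradNormSq (θ t) ≠ ⊤ := by
    intro htop
    apply hDfin
    rw [hD, Torus.eScalarDissipation, htop, ENNReal.mul_top]
    exact (ENNReal.ofReal_pos.2 hκ).ne'
  -- the Bochner integral of the real rate is dominated by the lower integral
  have hint : ∫ t in Ioc 0 T, (Torus.eScalarGradNormSq (θ t)).toReal ≤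
      (∫⁻ t in Ioo 0 T, Torus.eScalarGradNormSq (θ t)).toReal := by
    refine (ENNReal.ofReal_le_iff_le_toReal hIfin).1 ?_
    calc ENNReal.ofReal (∫ t in Ioc 0 T, (Torus.eScalarGradNormSq (θ t)).toReal)
        ≤ ∫⁻ t in Ioc 0 T, ENNReal.ofReal ((Torus.eScalarGradNormSq (θ t)).toReal) :=
          ofReal_integral_le_lintegral_ofReal _
      _ ≤ ∫⁻ t in Ioc 0 T, Torus.eScalarGradNormSq (θ t) :=
          lintegral_mono fun t => ENNReal.ofReal_toReal_le
      _ = ∫⁻ t in Ioo 0 T, Torus.eScalarGradNormSq (θ t) := setLIntegral_congr Ioo_ae_eq_Ioc.symm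
  have hDreal : D.toReal = κ * (∫⁻ t in Ioo 0 T, Torus.eScalarGradNormSq (θ t)).toReal := by
    rw [hD, Torus.eScalarDissipation, ENNReal.toReal_mul, ENNReal.toReal_ofReal hκ.le]
  -- assemble
  simp only [timeMean, intervalIntegral.integral_of_le hT.le]
  rw [MeasureTheory.integral_const_mul]
  have hTinv : 0 ≤ T⁻¹ := inv_nonneg.2 hT.le
  calc T⁻¹ * (κ * ∫ t in Ioc 0 T, (Torus.eScalarGradNormSq (θ t)).toReal)
      ≤ T⁻¹ * (κ * (∫⁻ t in Ioo 0 T, Torus.eScalarGradNormSq (θ t)).toReal) := by gcongr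
    _ = T⁻¹ * D.toReal := by rw [hDreal]
    _ ≤ T⁻¹ * (R / 2) := by gcongr; linarith

end LongTimeCorner

/-! ## The fixed-scale bound per unit time -/

/-- **The fixed-scale bound (5.10) per unit time, with a steady source** (caveat (ii) of the
barrier, long-time form): let `u` have velocity budget `‖u‖_{L¹(0,T;C^{0,α})} ≤ K(T)` with
`K(T) ≤ K₀ + k̄T` for every `T > 0`, let `h` be a continuous steady source, `γ`-Hölder with constant
`L`, `‖θ₀‖_{C^{0,β}} ≤ M`, `κ > 0`, and let `θ` be a global weak solution of
`∂ₜθ + u·∇θ = κΔθ + h` (`Torus.IsWeakScalarTransportForced`) obeying the sourced energy inequality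
`‖θ(t)‖² + 2κ∫₀ᵗ‖∇θ‖² ≤ ‖θ₀‖² + 2∫₀ᵗ∫θh` for a.e. `t > 0` and `ess sup_{t>0} ‖θ(t)‖_{C^{0,β}} ≤ M`.
Then for every scale `0 < ε ≤ 1/4` the long-time mean dissipation obeys
`⟨κ‖∇θ‖²⟩ ≤ 2dC₁M² ε^{α+2β-1} k̄ + κ dC₁²M² ε^{2β-2} + 2LM ε^γ`, `C₁ = Torus.gradProfileMass d`,
`d = card d`: the datum term `M²ε^{2β}` and the transient budget `K₀` of the window bound are free
per unit time. [cite: DrivasEtAl2022, proof of Thm. 4, (5.9)–(5.10)] -/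
theorem DrivasElgindiIyerJeong2022_thm4_forced.longTimeAvgSup_le_fixedScale {d : Type*} [Fintype d]
    [DecidableEq d] {α β : ℝ≥0} (hβ : 0 < β) {K₀ : ℝ} {kbar M : ℝ≥0} {K : ℝ → ℝ≥0}
    {u : ℝ → UnitAddTorus d → EuclideanSpace ℝ d} (hu : ∀ T, 0 < T → MemLpHolder 1 α u (Ioo 0 T))
    (huK : ∀ T, 0 < T → eLpHolderNorm 1 α u (Ioo 0 T) ≤ K T)
    (hK : ∀ T, 0 < T → (K T : ℝ) ≤ K₀ + kbar * T)
    {θ₀ : UnitAddTorus d → ℝ} (hθ₀ : eBoundedHolderNorm β θ₀ ≤ M) {κ : ℝ} (hκ : 0 < κ)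
    {h : UnitAddTorus d → ℝ} (hhc : Continuous h) {L γ : ℝ≥0} (hh : HolderWith L γ h)
    {θ : ℝ → UnitAddTorus d → ℝ}
    (hθ : Torus.IsWeakScalarTransportForced κ u (fun _ => h) θ₀ θ)
    (henergy : ∀ᵐ t ∂((volume : Measure ℝ).restrict (Ioi 0)),
      (∫⁻ x, ‖θ t x‖ₑ ^ 2) + 2 * Torus.eScalarDissipation κ θ 0 t ≤
        ENNReal.ofReal ((∫ x, θ₀ x ^ 2) + 2 * ∫ s in Ioo 0 t, ∫ x, θ s x * h x))
    (hbound : ∀ᵐ t ∂((volume : Measure ℝ).restrict (Ioi 0)), eBoundedHolderNorm β (θ t) ≤ M)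
    {ε : ℝ} (hε : 0 < ε) (hε' : ε ≤ 1 / 4) :
    longTimeAvgSup (fun t => κ * (Torus.eScalarGradNormSq (θ t)).toReal) ≤
      (2 * Fintype.card d * Torus.gradProfileMass d * (M : ℝ) ^ 2 * ε ^ ((α : ℝ) + 2 * β - 1)) * kbar +
        κ * (Fintype.card d * (Torus.gradProfileMass d ^ 2 * (M : ℝ) ^ 2 * ε ^ (2 * (β : ℝ) - 2))) +
        2 * (L * ε ^ (γ : ℝ)) * M := by
  set c₁ : ℝ := 2 * Fintype.card d * Torus.gradProfileMass d * (M : ℝ) ^ 2 * ε ^ ((α : ℝ) + 2 * β - 1)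
    with hc₁
  set c₂ : ℝ := κ * (Fintype.card d * (Torus.gradProfileMass d ^ 2 * (M : ℝ) ^ 2 * ε ^ (2 * (β : ℝ) - 2)))
    with hc₂
  set c₃ : ℝ := 4 * ((L : ℝ) * ε ^ (γ : ℝ)) * M with hc₃
  have hC₁0 : 0 ≤ Torus.gradProfileMass d := Torus.gradProfileMass_nonneg
  have hc₁0 : 0 ≤ c₁ := by positivity
  have hc₂0 : 0 ≤ c₂ := by positivity
  have hc₃0 : 0 ≤ c₃ := by positivity
  set q : ℝ → ℝ := fun t => κ * (Torus.eScalarGradNormSq (θ t)).toReal with hq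
  have hq0 : ∀ t, 0 ≤ q t := fun t => mul_nonneg hκ.le ENNReal.toReal_nonneg
  -- the transient part of the window bound, made nonnegative
  set A : ℝ := |(M : ℝ) ^ 2 * ε ^ (2 * (β : ℝ)) + 2 * (c₁ * K₀)| with hA
  have hA0 : 0 ≤ A := abs_nonneg _
  -- the window bound at every `T > 0`, divided by `T`
  have hwin : ∀ T, 0 < T → timeMean q T ≤ T⁻¹ * (A / 2) + (c₁ * kbar + c₂ + c₃ / 2) := by
    intro T hT
    have henT : ∀ᵐ t ∂((volume : Measure ℝ).restrict (Ioo 0 T)),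
        (∫⁻ x, ‖θ t x‖ₑ ^ 2) + 2 * Torus.eScalarDissipation κ θ 0 t ≤
          ENNReal.ofReal ((∫ x, θ₀ x ^ 2) + 2 * ∫ s in Ioo 0 t, ∫ x, θ s x * h x) :=
      ae_restrict_of_ae_restrict_of_subset Ioo_subset_Ioi_self henergy
    have hbdT : ∀ᵐ t ∂((volume : Measure ℝ).restrict (Ioo 0 T)), eBoundedHolderNorm β (θ t) ≤ M :=
      ae_restrict_of_ae_restrict_of_subset Ioo_subset_Ioi_self hbound
    have hraw := DrivasElgindiIyerJeong2022_thm4_forced.two_mul_eScalarDissipation_le hT hβ (hu T hT)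
      (huK T hT) hθ₀ hκ hhc hh (hθ T hT) henT hbdT hε hε'
    set R : ℝ := (M : ℝ) ^ 2 * ε ^ (2 * (β : ℝ)) + 2 * (c₁ * K T + T * c₂) + T * c₃ with hR
    have hR0 : 0 ≤ R := by positivity
    have hmean := LongTimeCorner.timeMean_dissipationRate_le hκ hT hR0 (R := R) (θ := θ) hraw
    have hKT := hK T hT
    have hRle : R ≤ A + T * (2 * (c₁ * kbar + c₂ + c₃ / 2)) := by
      have h1 : (M : ℝ) ^ 2 * ε ^ (2 * (β : ℝ)) + 2 * (c₁ * K₀) ≤ A := le_abs_self _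
      have h2 : c₁ * (K T : ℝ) ≤ c₁ * (K₀ + kbar * T) := mul_le_mul_of_nonneg_left hKT hc₁0
      rw [hR]
      nlinarith
    have hTinv : 0 ≤ T⁻¹ := inv_nonneg.2 hT.le
    calc timeMean q T ≤ T⁻¹ * (R / 2) := hmean
      _ ≤ T⁻¹ * ((A + T * (2 * (c₁ * kbar + c₂ + c₃ / 2))) / 2) := by gcongr
      _ = T⁻¹ * (A / 2) + (c₁ * kbar + c₂ + c₃ / 2) := by field_simp
  -- let `T → ∞`
  have hlim : ∀ δ : ℝ, 0 < δ → longTimeAvgSup q ≤ (c₁ * kbar + c₂ + c₃ / 2) + δ := by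
    intro δ hδ
    refine longTimeAvgSup_le_of_eventually_le hq0 ?_
    filter_upwards [eventually_gt_atTop (0 : ℝ), eventually_ge_atTop (A / (2 * δ))] with T hT hTA
    have h1 : T⁻¹ * (A / 2) ≤ δ := by
      rw [inv_mul_le_iff₀ hT]
      have : A ≤ T * (2 * δ) := by
        have := (div_le_iff₀ (by positivity : (0 : ℝ) < 2 * δ)).1 hTA
        linarith
      linarith
    linarith [hwin T hT]
  have hfin : longTimeAvgSup q ≤ c₁ * kbar + c₂ + c₃ / 2 :=
    le_of_forall_pos_le_add fun δ hδ => hlim δ hδ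
  calc longTimeAvgSup q ≤ c₁ * kbar + c₂ + c₃ / 2 := hfin
    _ = c₁ * kbar + c₂ + 2 * (L * ε ^ (γ : ℝ)) * M := by rw [hc₃]; ring

/-! ## The optimised bounds, in the quantifier shape of the named fact -/

/-- **The Obukhov–Corrsin threshold in long-time mean, with a steady Hölder source** (scope caveat
(ii) of `DrivasElgindiIyerJeong2022_thm4`, "REACH IN TIME AND FORCING", now a theorem in the
summit's own currency of `limsup` long-time means): let `α ∈ (0,1]`, `β ∈ (0,1]`, `γ ≥ 0`. For all
`k̄, M, L, κ₀` there is `C = C(d, α, β, γ, k̄, M, L, κ₀)` — depending neither on a window, nor on the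
transient velocity budget `K₀`, nor on the datum beyond `M` — such that: whenever `u` is a field
with `‖u‖_{L¹(0,T;C^{0,α})} ≤ K(T) ≤ K₀ + k̄T` for every `T > 0` (e.g. `ess sup_t ‖u(t)‖_{C^{0,α}} ≤ k̄`),
`h` is a continuous steady source, `γ`-Hölder with constant `L`, `‖θ₀‖_{C^{0,β}} ≤ M`,
`0 < κ ≤ κ₀`, and `θ` is a global weak solution of `∂ₜθ + u·∇θ = κΔθ + h`, `θ(0) = θ₀`
(`Torus.IsWeakScalarTransportForced`) obeying the sourced energy inequality for a.e. `t > 0` and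
`ess sup_{t>0} ‖θ(t)‖_{C^{0,β}} ≤ M`, then
`⟨κ‖∇θ‖²⟩ := limsup_{T→∞} T⁻¹∫₀ᵀ κ‖∇θ(t)‖²_{L²} dt ≤ C (κ^{(α+2β-1)/(α+1)} + κ^{γ/(α+1)})`.
Above the line `α + 2β > 1` (and `γ > 0`) a steadily sourced scalar bounded time-uniformly in
`C^{0,β}` over a field with bounded per-unit-time `L¹C^{0,α}` budget therefore carries no anomalous
dissipation in long-time mean either. The constant is
`C = (2dC₁M²k̄ c^{α+2β-1} + dC₁²M² c^{2β-2}) + 2LM c^γ`, `c = ¼κ₀^{-1/(α+1)}`,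
`C₁ = Torus.gradProfileMass d`. [cite: DrivasEtAl2022, Thm. 4 and §5 (5.9)–(5.10)] -/
theorem DrivasElgindiIyerJeong2022_thm4_forced_longTime :
    ∀ (d : Type) [Fintype d] [DecidableEq d] (α β : ℝ≥0)
      (_hα : 0 < α ∧ α ≤ 1) (_hβ : 0 < β ∧ β ≤ 1) (γ kbar M L κ₀ : ℝ≥0),
      ∃ C : ℝ≥0,
        ∀ (K₀ : ℝ) (K : ℝ → ℝ≥0) (u : ℝ → UnitAddTorus d → EuclideanSpace ℝ d)
          (_hu : ∀ T, 0 < T → MemLpHolder 1 α u (Ioo 0 T))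
          (_huK : ∀ T, 0 < T → eLpHolderNorm 1 α u (Ioo 0 T) ≤ K T)
          (_hK : ∀ T, 0 < T → (K T : ℝ) ≤ K₀ + kbar * T)
          (h : UnitAddTorus d → ℝ) (_hhc : Continuous h) (_hh : HolderWith L γ h)
          (θ₀ : UnitAddTorus d → ℝ) (_hθ₀ : eBoundedHolderNorm β θ₀ ≤ M)
          (κ : ℝ) (_hκ : 0 < κ) (_hκ₀ : κ ≤ κ₀)
          (θ : ℝ → UnitAddTorus d → ℝ)
          (_hθ : Torus.IsWeakScalarTransportForced κ u (fun _ => h) θ₀ θ)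
          (_henergy : ∀ᵐ t ∂(volume.restrict (Ioi 0)),
            (∫⁻ x, ‖θ t x‖ₑ ^ 2) + 2 * Torus.eScalarDissipation κ θ 0 t ≤
              ENNReal.ofReal ((∫ x, θ₀ x ^ 2) + 2 * ∫ s in Ioo 0 t, ∫ x, θ s x * h x))
          (_hbound : ∀ᵐ t ∂(volume.restrict (Ioi 0)), eBoundedHolderNorm β (θ t) ≤ M),
          longTimeAvgSup (fun t => κ * (Torus.eScalarGradNormSq (θ t)).toReal) ≤
            C * (κ ^ (((α : ℝ) + 2 * β - 1) / (α + 1)) + κ ^ ((γ : ℝ) / ((α : ℝ) + 1))) := by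
  intro d _ _ α β hα hβ γ kbar M L κ₀
  rcases eq_zero_or_pos κ₀ with hκ₀ | hκ₀
  · refine ⟨0, ?_⟩
    intro K₀ K u _ _ _ h _ _ θ₀ _ κ hκ hκκ₀
    exact absurd (hκ.trans_le hκκ₀) (by simp [hκ₀])
  -- the scale `ε = c κ^γ₁`, `γ₁ = 1/(α+1)`, uniform in the window
  set γ₁ : ℝ := ((α : ℝ) + 1)⁻¹ with hγ₁
  have hα1pos : (0 : ℝ) < α + 1 := by positivity
  have hγ₁0 : 0 ≤ γ₁ := by positivity
  have hκ₀' : (0 : ℝ) < κ₀ := hκ₀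
  set c : ℝ := 4⁻¹ * (κ₀ : ℝ) ^ (-γ₁) with hc
  have hc0 : 0 < c := by positivity
  set C₁ : ℝ := Torus.gradProfileMass d with hC₁
  have hC₁0 : 0 ≤ C₁ := Torus.gradProfileMass_nonneg
  set Cr : ℝ := (2 * Fintype.card d * C₁ * (M : ℝ) ^ 2 * kbar) * c ^ ((α : ℝ) + 2 * β - 1) +
      (Fintype.card d * (C₁ ^ 2 * (M : ℝ) ^ 2)) * c ^ (2 * (β : ℝ) - 2) with hCr
  have hCr0 : 0 ≤ Cr := by positivity
  set Cs : ℝ := 2 * ((L : ℝ) * c ^ (γ : ℝ)) * M with hCs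
  have hCs0 : 0 ≤ Cs := by positivity
  refine ⟨(Cr + Cs).toNNReal, ?_⟩
  intro K₀ K u hu huK hK h hhc hh θ₀ hθ₀ κ hκ hκκ₀ θ hθ henergy hbound
  set ε : ℝ := c * κ ^ γ₁ with hε_def
  have hε : 0 < ε := by positivity
  have hε' : ε ≤ 1 / 4 := by
    have h1 : κ ^ γ₁ ≤ (κ₀ : ℝ) ^ γ₁ := Real.rpow_le_rpow hκ.le (by exact_mod_cast hκκ₀) hγ₁0
    have h2 : (κ₀ : ℝ) ^ (-γ₁) * (κ₀ : ℝ) ^ γ₁ = 1 := by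
      rw [Real.rpow_neg hκ₀'.le, inv_mul_cancel₀ (Real.rpow_pos_of_pos hκ₀' γ₁).ne']
    calc ε = 4⁻¹ * ((κ₀ : ℝ) ^ (-γ₁) * κ ^ γ₁) := by rw [hε_def, hc, mul_assoc]
      _ ≤ 4⁻¹ * ((κ₀ : ℝ) ^ (-γ₁) * (κ₀ : ℝ) ^ γ₁) := by gcongr
      _ = 1 / 4 := by rw [h2]; norm_num
  have hraw := DrivasElgindiIyerJeong2022_thm4_forced.longTimeAvgSup_le_fixedScale hβ.1 hu huK hK
    hθ₀ hκ hhc hh hθ henergy hbound hε hε'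
  -- optimisation in `ℓ`: the two surviving unforced terms (no datum term per unit time)
  have hscale := scale_bound (β := (β : ℝ)) (2 * Fintype.card d * C₁ * (M : ℝ) ^ 2 * kbar)
    (Fintype.card d * (C₁ ^ 2 * (M : ℝ) ^ 2)) (by exact_mod_cast hα.2) hα1pos hκ
    (by exact_mod_cast hκκ₀) hc0 hγ₁ (le_refl (0 : ℝ))
  -- and the source term `ε^γ = c^γ κ^{γ/(α+1)}`
  have hsrc : 2 * ((L : ℝ) * ε ^ (γ : ℝ)) * M = Cs * κ ^ ((γ : ℝ) / ((α : ℝ) + 1)) := by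
    have e : ε ^ (γ : ℝ) = c ^ (γ : ℝ) * κ ^ ((γ : ℝ) / ((α : ℝ) + 1)) := by
      rw [hε_def, Real.mul_rpow hc0.le (Real.rpow_nonneg hκ.le _), ← Real.rpow_mul hκ.le, hγ₁,
        inv_mul_eq_div]
    rw [e, hCs]
    ring
  set e₁ : ℝ := ((α : ℝ) + 2 * β - 1) / (α + 1) with he₁
  set e₂ : ℝ := (γ : ℝ) / ((α : ℝ) + 1) with he₂
  have hκe₁ : 0 ≤ κ ^ e₁ := Real.rpow_nonneg hκ.le _
  have hκe₂ : 0 ≤ κ ^ e₂ := Real.rpow_nonneg hκ.le _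
  have h3 : (2 * Fintype.card d * C₁ * (M : ℝ) ^ 2 * ε ^ ((α : ℝ) + 2 * β - 1)) * kbar +
      κ * (Fintype.card d * (C₁ ^ 2 * (M : ℝ) ^ 2 * ε ^ (2 * (β : ℝ) - 2))) ≤ Cr * κ ^ e₁ := by
    rw [hCr]
    calc _ = 0 * (c * κ ^ γ₁) ^ (2 * (β : ℝ)) +
          (2 * Fintype.card d * C₁ * (M : ℝ) ^ 2 * kbar) * (c * κ ^ γ₁) ^ ((α : ℝ) + 2 * β - 1) +
          (Fintype.card d * (C₁ ^ 2 * (M : ℝ) ^ 2)) * (κ * (c * κ ^ γ₁) ^ (2 * (β : ℝ) - 2)) := by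
          rw [hε_def]; ring
      _ ≤ _ := hscale
      _ = _ := by rw [he₁]; ring
  calc longTimeAvgSup (fun t => κ * (Torus.eScalarGradNormSq (θ t)).toReal)
      ≤ (2 * Fintype.card d * C₁ * (M : ℝ) ^ 2 * ε ^ ((α : ℝ) + 2 * β - 1)) * kbar +
          κ * (Fintype.card d * (C₁ ^ 2 * (M : ℝ) ^ 2 * ε ^ (2 * (β : ℝ) - 2))) +
          2 * ((L : ℝ) * ε ^ (γ : ℝ)) * M := hraw
    _ ≤ Cr * κ ^ e₁ + Cs * κ ^ e₂ := by rw [hsrc]; linarith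
    _ ≤ ((Cr + Cs).toNNReal : ℝ≥0) * (κ ^ e₁ + κ ^ e₂) := by
        rw [Real.coe_toNNReal _ (add_nonneg hCr0 hCs0)]
        nlinarith [mul_nonneg hCr0 hκe₂, mul_nonneg hCs0 hκe₁]

/-- **The Obukhov–Corrsin threshold in long-time mean, unforced** (scope caveat (ii) of
`DrivasElgindiIyerJeong2022_thm4`, the `limsup`-per-unit-time transcription of the print's (5.10),
now a theorem): let `α ∈ (0,1]`, `β ∈ (0,1]`. For all `k̄, M, κ₀` there is `C = C(d, α, β, k̄, M, κ₀)`
such that: whenever `‖u‖_{L¹(0,T;C^{0,α})} ≤ K(T) ≤ K₀ + k̄T` for every `T > 0`, `‖θ₀‖_{C^{0,β}} ≤ M`,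
`0 < κ ≤ κ₀`, and `θ` is a weak solution of `∂ₜθ + u·∇θ = κΔθ`, `θ(0) = θ₀` on every window
(`Torus.IsWeakScalarTransportOn T` for all `T > 0`) obeying the energy balance (1.2) for a.e. `t > 0`
and `ess sup_{t>0} ‖θ(t)‖_{C^{0,β}} ≤ M`, then `⟨κ‖∇θ‖²⟩ ≤ C κ^{(α+2β-1)/(α+1)}` with
`C = 2dC₁M²k̄ c^{α+2β-1} + dC₁²M² c^{2β-2}`, `c = ¼κ₀^{-1/(α+1)}` — "per unit time the bound is
uniform in `T` under time-uniform bounds" (caveat (ii)), the datum term and the transient budget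
`K₀` being free. From the forced statement with `h = 0`. [cite: DrivasEtAl2022, Thm. 4 and §5 (5.10)] -/
theorem DrivasElgindiIyerJeong2022_thm4_longTime :
    ∀ (d : Type) [Fintype d] [DecidableEq d] (α β : ℝ≥0)
      (_hα : 0 < α ∧ α ≤ 1) (_hβ : 0 < β ∧ β ≤ 1) (kbar M κ₀ : ℝ≥0),
      ∃ C : ℝ≥0,
        ∀ (K₀ : ℝ) (K : ℝ → ℝ≥0) (u : ℝ → UnitAddTorus d → EuclideanSpace ℝ d)
          (_hu : ∀ T, 0 < T → MemLpHolder 1 α u (Ioo 0 T))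
          (_huK : ∀ T, 0 < T → eLpHolderNorm 1 α u (Ioo 0 T) ≤ K T)
          (_hK : ∀ T, 0 < T → (K T : ℝ) ≤ K₀ + kbar * T)
          (θ₀ : UnitAddTorus d → ℝ) (_hθ₀ : eBoundedHolderNorm β θ₀ ≤ M)
          (κ : ℝ) (_hκ : 0 < κ) (_hκ₀ : κ ≤ κ₀)
          (θ : ℝ → UnitAddTorus d → ℝ)
          (_hθ : ∀ T, 0 < T → Torus.IsWeakScalarTransportOn T κ u θ₀ θ)
          (_henergy : ∀ᵐ t ∂(volume.restrict (Ioi 0)),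
            (∫⁻ x, ‖θ t x‖ₑ ^ 2) + 2 * Torus.eScalarDissipation κ θ 0 t ≤ ∫⁻ x, ‖θ₀ x‖ₑ ^ 2)
          (_hbound : ∀ᵐ t ∂(volume.restrict (Ioi 0)), eBoundedHolderNorm β (θ t) ≤ M),
          longTimeAvgSup (fun t => κ * (Torus.eScalarGradNormSq (θ t)).toReal) ≤
            C * κ ^ (((α : ℝ) + 2 * β - 1) / (α + 1)) := by
  intro d _ _ α β hα hβ kbar M κ₀
  rcases eq_zero_or_pos κ₀ with hκ₀ | hκ₀
  · refine ⟨0, ?_⟩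
    intro K₀ K u _ _ _ θ₀ _ κ hκ hκκ₀
    exact absurd (hκ.trans_le hκκ₀) (by simp [hκ₀])
  set γ₁ : ℝ := ((α : ℝ) + 1)⁻¹ with hγ₁
  have hα1pos : (0 : ℝ) < α + 1 := by positivity
  have hγ₁0 : 0 ≤ γ₁ := by positivity
  have hκ₀' : (0 : ℝ) < κ₀ := hκ₀
  set c : ℝ := 4⁻¹ * (κ₀ : ℝ) ^ (-γ₁) with hc
  have hc0 : 0 < c := by positivity
  set C₁ : ℝ := Torus.gradProfileMass d with hC₁
  have hC₁0 : 0 ≤ C₁ := Torus.gradProfileMass_nonneg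
  set Cr : ℝ := (2 * Fintype.card d * C₁ * (M : ℝ) ^ 2 * kbar) * c ^ ((α : ℝ) + 2 * β - 1) +
      (Fintype.card d * (C₁ ^ 2 * (M : ℝ) ^ 2)) * c ^ (2 * (β : ℝ) - 2) with hCr
  have hCr0 : 0 ≤ Cr := by positivity
  refine ⟨Cr.toNNReal, ?_⟩
  intro K₀ K u hu huK hK θ₀ hθ₀ κ hκ hκκ₀ θ hθ henergy hbound
  set ε : ℝ := c * κ ^ γ₁ with hε_def
  have hε : 0 < ε := by positivity
  have hε' : ε ≤ 1 / 4 := by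
    have h1 : κ ^ γ₁ ≤ (κ₀ : ℝ) ^ γ₁ := Real.rpow_le_rpow hκ.le (by exact_mod_cast hκκ₀) hγ₁0
    have h2 : (κ₀ : ℝ) ^ (-γ₁) * (κ₀ : ℝ) ^ γ₁ = 1 := by
      rw [Real.rpow_neg hκ₀'.le, inv_mul_cancel₀ (Real.rpow_pos_of_pos hκ₀' γ₁).ne']
    calc ε = 4⁻¹ * ((κ₀ : ℝ) ^ (-γ₁) * κ ^ γ₁) := by rw [hε_def, hc, mul_assoc]
      _ ≤ 4⁻¹ * ((κ₀ : ℝ) ^ (-γ₁) * (κ₀ : ℝ) ^ γ₁) := by gcongr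
      _ = 1 / 4 := by rw [h2]; norm_num
  -- the unforced solution as a forced one with source `0`
  have hθ₀c : Continuous θ₀ := by
    have hB : MemBoundedHolder β θ₀ := lt_of_le_of_lt hθ₀ ENNReal.coe_lt_top
    exact hB.continuous hβ.1
  have hθ' : Torus.IsWeakScalarTransportForced κ u (fun _ => (0 : UnitAddTorus d → ℝ)) θ₀ θ :=
    fun T hT => Torus.isWeakScalarTransportForcedOn_zero_iff.2 (hθ T hT)
  have henergy' : ∀ᵐ t ∂((volume : Measure ℝ).restrict (Ioi 0)),
      (∫⁻ x, ‖θ t x‖ₑ ^ 2) + 2 * Torus.eScalarDissipation κ θ 0 t ≤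
        ENNReal.ofReal ((∫ x, θ₀ x ^ 2) + 2 * ∫ s in Ioo 0 t, ∫ x, θ s x * (0 : UnitAddTorus d → ℝ) x) := by
    have e0 : ∫⁻ x, ‖θ₀ x‖ₑ ^ 2 = ENNReal.ofReal (∫ x, θ₀ x ^ 2) :=
      Torus.lintegral_enorm_sq_eq_ofReal_integral_sq hθ₀c
    filter_upwards [henergy] with t ht
    simpa only [Pi.zero_apply, mul_zero, integral_zero, add_zero, e0] using ht
  have hh : HolderWith (0 : ℝ≥0) (1 : ℝ≥0) (0 : UnitAddTorus d → ℝ) := fun x y => by simp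
  have hraw := DrivasElgindiIyerJeong2022_thm4_forced.longTimeAvgSup_le_fixedScale hβ.1 hu huK hK
    hθ₀ hκ continuous_zero hh hθ' henergy' hbound hε hε'
  have hscale := scale_bound (β := (β : ℝ)) (2 * Fintype.card d * C₁ * (M : ℝ) ^ 2 * kbar)
    (Fintype.card d * (C₁ ^ 2 * (M : ℝ) ^ 2)) (by exact_mod_cast hα.2) hα1pos hκ
    (by exact_mod_cast hκκ₀) hc0 hγ₁ (le_refl (0 : ℝ))
  set e₁ : ℝ := ((α : ℝ) + 2 * β - 1) / (α + 1) with he₁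
  have hκe₁ : 0 ≤ κ ^ e₁ := Real.rpow_nonneg hκ.le _
  have h3 : (2 * Fintype.card d * C₁ * (M : ℝ) ^ 2 * ε ^ ((α : ℝ) + 2 * β - 1)) * kbar +
      κ * (Fintype.card d * (C₁ ^ 2 * (M : ℝ) ^ 2 * ε ^ (2 * (β : ℝ) - 2))) ≤ Cr * κ ^ e₁ := by
    rw [hCr]
    calc _ = 0 * (c * κ ^ γ₁) ^ (2 * (β : ℝ)) +
          (2 * Fintype.card d * C₁ * (M : ℝ) ^ 2 * kbar) * (c * κ ^ γ₁) ^ ((α : ℝ) + 2 * β - 1) +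
          (Fintype.card d * (C₁ ^ 2 * (M : ℝ) ^ 2)) * (κ * (c * κ ^ γ₁) ^ (2 * (β : ℝ) - 2)) := by
          rw [hε_def]; ring
      _ ≤ _ := hscale
      _ = _ := by rw [he₁]; ring
  calc longTimeAvgSup (fun t => κ * (Torus.eScalarGradNormSq (θ t)).toReal)
      ≤ (2 * Fintype.card d * C₁ * (M : ℝ) ^ 2 * ε ^ ((α : ℝ) + 2 * β - 1)) * kbar +
          κ * (Fintype.card d * (C₁ ^ 2 * (M : ℝ) ^ 2 * ε ^ (2 * (β : ℝ) - 2))) +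
          2 * (((0 : ℝ≥0) : ℝ) * ε ^ ((1 : ℝ≥0) : ℝ)) * M := hraw
    _ ≤ Cr * κ ^ e₁ := by simp only [NNReal.coe_zero, zero_mul, mul_zero, add_zero]; exact h3
    _ = (Cr.toNNReal : ℝ≥0) * κ ^ e₁ := by rw [Real.coe_toNNReal _ hCr0]

/-! ## No dissipation floor along steadily sourced families above the line -/

/-- **No anomalous scalar dissipation in long-time mean above the Obukhov–Corrsin threshold, along
STEADILY SOURCED families** (the long-time forced reading of `blocks:`; from
`DrivasElgindiIyerJeong2022_thm4_forced_longTime` exactly as the window corollaries follow from the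
window theorems): let `α + 2β > 1`, `γ > 0`, `κ_j > 0` with `κ_j → 0`, and for each `j` let `u_j`
have velocity budget `‖u_j‖_{L¹(0,T;C^{0,α})} ≤ K_j(T) ≤ K₀(j) + k̄T` for all `T > 0` — the transient
part `K₀(j)` may depend on `j` arbitrarily, only the rate `k̄` is uniform — continuous steady
sources `h_j`, `γ`-Hölder with constant `L`, data with `‖θ₀,ⱼ‖_{C^{0,β}} ≤ M`, and global weak
solutions `θ_j` of `∂ₜθ + u_j·∇θ = κ_jΔθ + h_j` obeying the sourced energy inequality for a.e. `t > 0`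
and `ess sup_{t>0} ‖θ_j(t)‖_{C^{0,β}} ≤ M`. Then the mean dissipations `⟨κ_j‖∇θ_j‖²⟩` tend to `0`.
[cite: DrivasEtAl2022, Thm. 4] -/
theorem DrivasElgindiIyerJeong2022_thm4_forced_longTime.noAnomalousMeanScalarDissipation (d : Type)
    [Fintype d] [DecidableEq d] (α β : ℝ≥0) (hα : 0 < α ∧ α ≤ 1) (hβ : 0 < β ∧ β ≤ 1)
    (hOC : 1 < (α : ℝ) + 2 * β) (γ : ℝ≥0) (hγ : 0 < γ) (kbar M L : ℝ≥0)
    (K₀ : ℕ → ℝ) (K : ℕ → ℝ → ℝ≥0)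
    (u : ℕ → ℝ → UnitAddTorus d → EuclideanSpace ℝ d)
    (hu : ∀ j T, 0 < T → MemLpHolder 1 α (u j) (Ioo 0 T))
    (huK : ∀ j T, 0 < T → eLpHolderNorm 1 α (u j) (Ioo 0 T) ≤ K j T)
    (hK : ∀ j T, 0 < T → (K j T : ℝ) ≤ K₀ j + kbar * T)
    (h : ℕ → UnitAddTorus d → ℝ) (hhc : ∀ j, Continuous (h j)) (hh : ∀ j, HolderWith L γ (h j))
    (θ₀ : ℕ → UnitAddTorus d → ℝ) (hθ₀ : ∀ j, eBoundedHolderNorm β (θ₀ j) ≤ M)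
    (κ : ℕ → ℝ) (hκ : ∀ j, 0 < κ j) (hκ₀ : Tendsto κ atTop (𝓝 0))
    (θ : ℕ → ℝ → UnitAddTorus d → ℝ)
    (hθ : ∀ j, Torus.IsWeakScalarTransportForced (κ j) (u j) (fun _ => h j) (θ₀ j) (θ j))
    (henergy : ∀ j, ∀ᵐ t ∂(volume.restrict (Ioi 0)),
      (∫⁻ x, ‖θ j t x‖ₑ ^ 2) + 2 * Torus.eScalarDissipation (κ j) (θ j) 0 t ≤
        ENNReal.ofReal ((∫ x, θ₀ j x ^ 2) + 2 * ∫ s in Ioo 0 t, ∫ x, θ j s x * h j x))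
    (hbound : ∀ j, ∀ᵐ t ∂(volume.restrict (Ioi 0)), eBoundedHolderNorm β (θ j t) ≤ M) :
    Tendsto (fun j => longTimeAvgSup (fun t => κ j * (Torus.eScalarGradNormSq (θ j t)).toReal))
      atTop (𝓝 0) := by
  obtain ⟨C, hC⟩ := DrivasElgindiIyerJeong2022_thm4_forced_longTime d α β hα hβ γ kbar M L 1
  have hpos : (0 : ℝ) < α + 1 := by positivity
  have hexp₁ : 0 < ((α : ℝ) + 2 * β - 1) / (α + 1) := div_pos (by linarith) hpos
  have hexp₂ : 0 < (γ : ℝ) / ((α : ℝ) + 1) := div_pos (by exact_mod_cast hγ) hpos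
  have hpow : Tendsto (fun j => κ j ^ (((α : ℝ) + 2 * β - 1) / (α + 1)) + κ j ^ ((γ : ℝ) / ((α : ℝ) + 1)))
      atTop (𝓝 0) := by
    simpa using (hκ₀.rpow_const_nhds_zero hexp₁).add (hκ₀.rpow_const_nhds_zero hexp₂)
  have hup : Tendsto (fun j => (C : ℝ) *
      (κ j ^ (((α : ℝ) + 2 * β - 1) / (α + 1)) + κ j ^ ((γ : ℝ) / ((α : ℝ) + 1)))) atTop (𝓝 0) := by
    simpa using hpow.const_mul (C : ℝ)
  have hev : ∀ᶠ j in atTop, κ j ≤ 1 :=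
    (hκ₀.eventually (Iic_mem_nhds one_pos)).mono fun j hj => hj
  refine tendsto_of_tendsto_of_tendsto_of_le_of_le' tendsto_const_nhds hup
    (Eventually.of_forall fun j =>
      longTimeAvgSup_nonneg fun t => mul_nonneg (hκ j).le ENNReal.toReal_nonneg)
    (hev.mono fun j hj => ?_)
  exact hC (K₀ j) (K j) (u j) (hu j) (huK j) (hK j) (h j) (hhc j) (hh j) (θ₀ j) (hθ₀ j) (κ j) (hκ j)
    (by exact_mod_cast hj) (θ j) (hθ j) (henergy j) (hbound j)

/-- **No dissipation floor** (the shape of the floor clause `∃ ε > 0, ∀ j, ε ≤ ⟨ν_j‖∇θ_j‖²⟩` of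
crux `ScalarAnomalySteadySourceFormal`, negated for the class of this file): under the hypotheses
of `DrivasElgindiIyerJeong2022_thm4_forced_longTime.noAnomalousMeanScalarDissipation` no `ε > 0`
lies below every mean dissipation `⟨κ_j‖∇θ_j‖²⟩`. [cite: DrivasEtAl2022, Thm. 4] -/
theorem DrivasElgindiIyerJeong2022_thm4_forced_longTime.no_dissipation_floor (d : Type)
    [Fintype d] [DecidableEq d] (α β : ℝ≥0) (hα : 0 < α ∧ α ≤ 1) (hβ : 0 < β ∧ β ≤ 1)
    (hOC : 1 < (α : ℝ) + 2 * β) (γ : ℝ≥0) (hγ : 0 < γ) (kbar M L : ℝ≥0)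
    (K₀ : ℕ → ℝ) (K : ℕ → ℝ → ℝ≥0)
    (u : ℕ → ℝ → UnitAddTorus d → EuclideanSpace ℝ d)
    (hu : ∀ j T, 0 < T → MemLpHolder 1 α (u j) (Ioo 0 T))
    (huK : ∀ j T, 0 < T → eLpHolderNorm 1 α (u j) (Ioo 0 T) ≤ K j T)
    (hK : ∀ j T, 0 < T → (K j T : ℝ) ≤ K₀ j + kbar * T)
    (h : ℕ → UnitAddTorus d → ℝ) (hhc : ∀ j, Continuous (h j)) (hh : ∀ j, HolderWith L γ (h j))
    (θ₀ : ℕ → UnitAddTorus d → ℝ) (hθ₀ : ∀ j, eBoundedHolderNorm β (θ₀ j) ≤ M)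
    (κ : ℕ → ℝ) (hκ : ∀ j, 0 < κ j) (hκ₀ : Tendsto κ atTop (𝓝 0))
    (θ : ℕ → ℝ → UnitAddTorus d → ℝ)
    (hθ : ∀ j, Torus.IsWeakScalarTransportForced (κ j) (u j) (fun _ => h j) (θ₀ j) (θ j))
    (henergy : ∀ j, ∀ᵐ t ∂(volume.restrict (Ioi 0)),
      (∫⁻ x, ‖θ j t x‖ₑ ^ 2) + 2 * Torus.eScalarDissipation (κ j) (θ j) 0 t ≤
        ENNReal.ofReal ((∫ x, θ₀ j x ^ 2) + 2 * ∫ s in Ioo 0 t, ∫ x, θ j s x * h j x))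
    (hbound : ∀ j, ∀ᵐ t ∂(volume.restrict (Ioi 0)), eBoundedHolderNorm β (θ j t) ≤ M) :
    ¬ ∃ ε : ℝ, 0 < ε ∧ ∀ j, ε ≤ longTimeAvgSup (fun t => κ j * (Torus.eScalarGradNormSq (θ j t)).toReal) := by
  rintro ⟨ε, hε, hfloor⟩
  have hT := DrivasElgindiIyerJeong2022_thm4_forced_longTime.noAnomalousMeanScalarDissipation d α β hα
    hβ hOC γ hγ kbar M L K₀ K u hu huK hK h hhc hh θ₀ hθ₀ κ hκ hκ₀ θ hθ henergy hbound
  have hlt : ∀ᶠ j in atTop,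
      longTimeAvgSup (fun t => κ j * (Torus.eScalarGradNormSq (θ j t)).toReal) < ε :=
    hT (Iio_mem_nhds hε)
  obtain ⟨j, hj⟩ := hlt.exists
  exact absurd (hfloor j) (not_le.2 hj)

end Literature.Barriers.AnomalousDissipation

end
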